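import Literature.NumberTheory.Sieve.ParityWave0LargeSieveProofs
import Mathlib.Data.Nat.Totient
import Mathlib.Data.Nat.Factorization.Basic
import Mathlib.Algebra.BigOperators.Intervals
import HarnessLib

/-!
# Barrier catalogue `Parity`: the large sieve sets the limit `Q = x^{1/2}` for mean-value
# theorems in arithmetic progressions (Bombieri–Friedlander–Iwaniec 1986) — both terms of the
# large-sieve constant `Q² + N − 1` are necessary (Montgomery 1978), PROVED

Catalogue entry (D-0021) for the summit `Parity`, sub-problem `GeneralizedHardyLittlewood`. The
routes to the binary case of `Literature.NumberTheory.Sieve.GeneralizedHardyLittlewood` through levels of distribution of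
the primes beyond `x^{1/2}` (route `MobiusShiftedPrimes` of this sub-problem takes the
Elliott–Halberstam conjecture `Literature.NumberTheory.Sieve.LevelOfDistribution.ElliottHalberstam` — level `x^θ` for every `θ < 1` — as a
conjunct; `Literature.NumberTheory.Sieve.bombieri_vinogradov` / `Literature.NumberTheory.Sieve.BombieriVinogradovStatement` is the known range
`θ < 1/2`) meet the documented limit of the large-sieve method: "It is the application of the large
sieve inequality (1.6) that sets the limit `Q = x^{1/2} 𝓛^{-B}` and not the shape of the bilinear
form `α ⋆ β`" (Bombieri–Friedlander–Iwaniec). The rigorous kernel is the optimality of the large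
sieve inequality (parity.S33, `Literature.NumberTheory.Sieve.large_sieve_inequality`, proved in the tree with
Selberg's constant `Q² + N − 1`): Montgomery's two examples show that an admissible constant must
be `≥ N` and `≥ ∑_{q ≤ Q} φ(q) ≍ Q²`. The catalogued declaration is `LargeSieveLevelHalf`
(docstring = BARRIER block), PROVED (`LargeSieveLevelHalf_holds`).

**NARROWED by the 2026-08-16 barrier audit** (file `LargeSieveLevelHalfNarrow.lean`, record
`LargeSieveLevelHalfNarrow`, PROVED there and implying this one): (1) the `Q²` of the large-sieve
constant is paid by EVERY sequence once the moduli exceed its length — for a prime `p ≥ N`,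
`∑_{0<b<p} |S(b/p)|² ≥ (p − N)∑|a_n|²` (Parseval modulo `p`), so
`∑_{q ≤ Q}∑_{(b,q)=1}|S(b/q)|² ≥ (∑_{N ≤ p ≤ Q}(p − N))∑|a_n|² ≍ Q²∑|a_n|²/log Q` whatever the
coefficients; beyond `x^{1/2}` the large-sieve step of the Bombieri–Vinogradov architecture is
therefore lossless up to `O(log Q)` for the actual pieces of `Λ`, and the `x^{1/2}` ceiling sits
one step upstream, in the absolute-value bound `φ(q)⁻¹∑_χ |A(χ)B(χ)|` on the character expansion
over the complete family of moduli ("would imply some cancellation for sums over zeroes of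
different `L`-functions", Maynard 2020 I, §1); (2) `max_{(a,q)=1}` is NOT what is blocked beyond
`x^{1/2}`: Maynard, *Large moduli III: Uniform residue classes* (Mem. AMS 1544) keeps
`sup_{(a,q)=1}` inside a Bombieri–Vinogradov sum at level `x^{1/2+δ}` for moduli with a factor
near `x^{1/10}` (Theorems 1.1–1.3), so the last clause of `evasions_known:` below is superseded.
See the AUDIT clauses in the block.

* `IsLargeSieveConstant N Q Δ` — the technique-class parameter: `Δ` is an admissible constant in
  `∑_{q ≤ Q} ∑_{(b,q)=1} |∑_{M<n≤M+N} a_n e(bn/q)|² ≤ Δ ∑ |a_n|²` (all `a`, all `M`);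
* `isLargeSieveConstant_sq_add` — `Q² + N − 1` is admissible (tree:
  `Literature.NumberTheory.Sieve.large_sieve_inequality_holds`);
* `le_of_isLargeSieveConstant` — `Δ ≥ N` (constant sequence; the term `q = 1`);
* `totientSum_le_of_isLargeSieveConstant` — `Δ ≥ Φ(Q) := ∑_{q ≤ Q} φ(q)` (one-term sequence);
* `sq_le_four_mul_totientSum` — the elementary bound `Q² ≤ 4 Φ(Q)` (from `∑_{d∣n} φ(d) = n`);
* `LargeSieveLevelHalf_holds` — hence `max(N, Q²/4) ≤ Δ ≤ Q² + N − 1` for every admissible `Δ`.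

## What the sources print (verified on the page)

* E. Bombieri, J. B. Friedlander, H. Iwaniec, *Primes in arithmetic progressions to large moduli*,
  Acta Math. 156 (1986) 203–251 [cite: BombieriFriedlanderIwaniecActa1986, §1 (pp. 205–209): (1.4)–(1.7), (A₁)–(A₂), Theorems 8–10, Corollary 2, Conjectures 1–2].
  After (1.4): Bombieri–Vinogradov (1.4) `∑_{q ≤ Q} max_{(a,q)=1} |ψ(x;q,a) − x/φ(q)| ≪ x𝓛^{-A}` "with
  `Q = x^{1/2}𝓛^{-B}`"; "It was conjectured by P. D. T. A. Elliott and H. Halberstam [3] that (1.4)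
  may hold with `Q = x^{1−ε}` but even the result with `Q = x^{1/2}` has not yet been achieved."
  Then: under (A₁) (`α = (α_m)`, `m ∼ M = x^{1−ϑ}`, `β = (β_n)`, `n ∼ N = x^ϑ`,
  `ε ≤ ϑ ≤ 1 − ε`) and (A₂) (Siegel–Walfisz for `β`), (1.5)
  `∑_{q ≤ Q} max_a |Δ_{α⋆β}(x;q,a)| ≪ ‖α‖‖β‖x^{1/2}𝓛^{-A}` "with `Q = x^{1/2}𝓛^{-B}` … The proof is
  a consequence of the large sieve inequality (see Theorem 0 below) (1.6)
  `∑_{q ≤ Q} ∑*_{χ mod q} |∑_{h ≤ H} C_h χ(h)|² ≪ (Q² + H)‖C‖²`"; "It is the application of the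
  large sieve inequality (1.6) that sets the limit `Q = x^{1/2}𝓛^{-B}` and not the shape of the
  bilinear form `α ⋆ β`. By this we mean that the location of `ϑ` in `[ε, 1−ε]` in (A₁) is
  irrelevant to the proof. In the series of papers by E. Fouvry and H. Iwaniec … the first
  successful attempts were made to get mean value theorems for arithmetic progressions to moduli
  beyond `x^{1/2}`. The large sieve inequality (1.6) is replaced by new arguments based on the
  dispersion method, Fourier analysis and Kloosterman sums … In these new arguments the parameter
  `a` is now forced to be (more or less) fixed so we must drop from both (1.5) and (1.4) the
  expression `max_{(a,q)=1}`"; (1.7) with `Q = x^{1/2+δ}` for general weights `γ_q` "cannot yet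
  be done". Theorem 8 (`θ₁ < 1/3`, `θ₂ < 1/5`, …), Theorem 9, Theorem 10 (fixed `a ≠ 0`,
  well factorable `λ` of level `Q = x^{4/7−ε}`:
  `∑_{(q,a)=1} λ(q)(ψ(x;q,a) − x/φ(q)) ≪ x𝓛^{-A}`), Corollary 2 (`π₂(x) ≤ (7/2 + ε)Bx(log x)^{-2}`).
  Conjectures 1–2 (level `x𝓛^{-B₁}`, resp. `x^{3/4−ε}`, for `∑_q |Δ_{α⋆β}|`, fixed `a`).
* H. L. Montgomery, *The analytic principle of the large sieve*, Bull. AMS 84 (1978)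
  [cite: Montgomery1978, p. 548]: the large sieve is "an inequality of the form
  `∑_r |S(α_r)|² ≤ Δ ∑ |a_n|²` (2) where `Δ = Δ(N, δ)`"; "we observe that `Δ` can not be too small.
  Suppose that `a_n = e(−nα₁)`. Then `|S(α₁)|² = N² = N ∑|a_n|²`; thus `Δ ≥ N`. … If the `α_r` are
  equally spaced … Hence for some value of `α`, … and thus `Δ ≥ [δ⁻¹] ≥ δ⁻¹ − 1`. The power of the
  large sieve may be attributed to the fact that we need not take `Δ` to be much larger than is
  necessitated by the elementary considerations above." (Farey points `b/q`, `q ≤ Q`, are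
  `Q⁻²`-spaced, so `δ⁻¹ = Q²`.)
* T. M. Apostol, *Introduction to Analytic Number Theory* (1976) [cite: Apostol1976, Thm 3.7]:
  `∑_{n ≤ x} φ(n) = (3/π²)x² + O(x log x)`.
* J. Maynard, *Primes in arithmetic progressions to large moduli II*, arXiv:2006.07088
  [cite: Maynard2020LargeModuliII, Theorems 1.1–1.2 and §1]: level `x^{3/5−ε}` with triply well
  factorable weights, `x^{7/12−ε}` for the well-factorable linear-sieve weights; "It appears that
  handling moduli of size `x^{3/5−ε}` is the limit of the current method."
* D. H. J. Polymath, *New equidistribution estimates of Zhang type*, arXiv:1402.0811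
  [cite: Polymath8a2014, Theorem 1.1 and the following paragraph]: `θ = 1/2 + 7/300` for smooth
  moduli and a fixed system of residues `a_q`; Zhang: `θ = 1/2 + 1/584`.
-/

noncomputable section

open Finset Real Nat
open scoped FourierTransform

namespace Literature.Barriers.Parity

/-! ### Admissible large-sieve constants and their necessary size -/

/-- **Technique-class parameter: admissible large-sieve constants.** `Δ` is admissible for
`(N, Q)` if the Farey-fraction large sieve inequality (parity.S33,
`Literature.NumberTheory.Sieve.large_sieve_inequality`) holds with constant `Δ`:
`∑_{q ≤ Q} ∑_{0 ≤ b < q, (b,q)=1} |∑_{M<n≤M+N} a_n e(bn/q)|² ≤ Δ ∑_{M<n≤M+N} |a_n|²` for all complex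
`a` and all `M` — Montgomery's `Δ(N, δ)` at `δ = Q⁻²`, BFI's (1.6).
[cite: Montgomery1978, p. 548 (2)] [cite: BombieriFriedlanderIwaniecActa1986, §1 (1.6)] -/
def IsLargeSieveConstant (N Q : ℕ) (Δ : ℝ) : Prop :=
  ∀ (a : ℤ → ℂ) (M : ℤ),
    ∑ q ∈ Icc 1 Q, ∑ b ∈ range q with b.Coprime q,
        ‖∑ n ∈ Ioc M (M + N), a n * (𝐞 ((b : ℝ) * n / q) : ℂ)‖ ^ 2 ≤
      Δ * ∑ n ∈ Ioc M (M + N), ‖a n‖ ^ 2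

/-- `Q² + N − 1` is admissible (Selberg's constant; the tree's proof of parity.S33,
`Literature.NumberTheory.Sieve.large_sieve_inequality_holds`). [cite: Montgomery1978, Thm 3] -/
theorem isLargeSieveConstant_sq_add (N Q : ℕ) :
    IsLargeSieveConstant N Q ((Q : ℝ) ^ 2 + N - 1) := fun a M =>
  Literature.NumberTheory.Sieve.large_sieve_inequality_holds a M N Q

/-- **Montgomery's first example: `Δ ≥ N`.** The constant sequence `a_n = 1` on `(0, N]`: the
term `q = 1`, `b = 0` alone is `|∑ 1|² = N² = N ∑|a_n|²` ("Suppose that `a_n = e(−nα₁)`. Then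
`|S(α₁)|² = N² = N∑|a_n|²`; thus `Δ ≥ N`"). [cite: Montgomery1978, p. 548] -/
theorem le_of_isLargeSieveConstant {N Q : ℕ} (hN : 1 ≤ N) (hQ : 1 ≤ Q) {Δ : ℝ}
    (h : IsLargeSieveConstant N Q Δ) : (N : ℝ) ≤ Δ := by
  classical
  have h1 := h (fun _ => 1) 0
  have hR : ∑ n ∈ Ioc (0 : ℤ) (0 + N), ‖(fun _ : ℤ => (1 : ℂ)) n‖ ^ 2 = N := by
    simp
  rw [hR] at h1
  have hterm : ((N : ℝ)) ^ 2 ≤ ∑ q ∈ Icc 1 Q, ∑ b ∈ range q with b.Coprime q,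
      ‖∑ n ∈ Ioc (0 : ℤ) (0 + N), (fun _ : ℤ => (1 : ℂ)) n * (𝐞 ((b : ℝ) * n / q) : ℂ)‖ ^ 2 := by
    have hq1 : (1 : ℕ) ∈ Icc 1 Q := by rw [mem_Icc]; omega
    refine le_trans ?_ (single_le_sum (f := fun q => ∑ b ∈ range q with b.Coprime q,
      ‖∑ n ∈ Ioc (0 : ℤ) (0 + N), (fun _ : ℤ => (1 : ℂ)) n * (𝐞 ((b : ℝ) * n / q) : ℂ)‖ ^ 2)
      (fun q _ => sum_nonneg fun b _ => by positivity) hq1)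
    have hfilter : (range 1).filter (fun b => b.Coprime 1) = {0} := by decide
    simp only [hfilter, sum_singleton, Nat.cast_zero, zero_mul, zero_div, Nat.cast_one]
    rw [AddChar.map_zero_eq_one]
    simp
  have hNpos : (0 : ℝ) < N := by exact_mod_cast hN
  nlinarith

/-- **Montgomery's second example: `Δ ≥ Φ(Q) = ∑_{q ≤ Q} φ(q)`.** The one-term sequence
`a = 1_{n = 1}`: every `(q, b)` contributes `|e(b/q)|² = 1`, so the left side is the number of
Farey fractions of order `Q`, `∑_{q ≤ Q} φ(q)` (the count `R = [δ⁻¹]` of `δ`-spaced points in the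
trigonometric form: "thus `Δ ≥ [δ⁻¹]`"). [cite: Montgomery1978, p. 548] -/
theorem totientSum_le_of_isLargeSieveConstant {N Q : ℕ} (hN : 1 ≤ N) {Δ : ℝ}
    (h : IsLargeSieveConstant N Q Δ) : (∑ q ∈ Icc 1 Q, (φ q : ℝ)) ≤ Δ := by
  classical
  have h1 := h (fun n => if n = 1 then 1 else 0) 0
  have hmem : (1 : ℤ) ∈ Ioc (0 : ℤ) (0 + N) := by rw [mem_Ioc]; omega
  have hR : ∑ n ∈ Ioc (0 : ℤ) (0 + N), ‖(fun n : ℤ => if n = 1 then (1 : ℂ) else 0) n‖ ^ 2 = 1 := by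
    rw [sum_eq_single_of_mem (1 : ℤ) hmem (fun n _ hn => by simp [hn])]
    simp
  rw [hR, mul_one] at h1
  refine le_trans (le_of_eq ?_) h1
  refine sum_congr rfl fun q hq => ?_
  have hinner : ∀ b ∈ (range q).filter (fun b => b.Coprime q),
      ‖∑ n ∈ Ioc (0 : ℤ) (0 + N), (fun n : ℤ => if n = 1 then (1 : ℂ) else 0) n *
        (𝐞 ((b : ℝ) * n / q) : ℂ)‖ ^ 2 = 1 := by
    intro b _
    rw [sum_eq_single_of_mem (1 : ℤ) hmem (fun n _ hn => by simp [hn])]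
    simp
  rw [sum_congr rfl hinner, sum_const, nsmul_eq_mul, mul_one, Nat.totient_eq_card_coprime]
  congr 2
  exact filter_congr fun b _ => Nat.coprime_comm

/-! ### An elementary quadratic lower bound for `Φ(Q) = ∑_{q ≤ Q} φ(q)` -/

/-- `∑_{d ≤ Q} φ(d) ⌊Q/d⌋ = ∑_{n ≤ Q} n` (sum `∑_{d ∣ n} φ(d) = n` over `n ≤ Q` and interchange).
[folklore] -/
theorem sum_totient_mul_div (Q : ℕ) :
    ∑ d ∈ Ioc 0 Q, φ d * (Q / d) = ∑ n ∈ Ioc 0 Q, n := by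
  classical
  calc ∑ d ∈ Ioc 0 Q, φ d * (Q / d)
      = ∑ d ∈ Ioc 0 Q, ∑ n ∈ (Ioc 0 Q).filter (d ∣ ·), φ d := by
        refine sum_congr rfl fun d _ => ?_
        rw [sum_const, smul_eq_mul, mul_comm, Nat.Ioc_filter_dvd_card_eq_div]
    _ = ∑ n ∈ Ioc 0 Q, ∑ d ∈ n.divisors, φ d := by
        refine sum_comm' fun d n => ?_
        simp only [mem_Ioc, mem_filter, Nat.mem_divisors]
        constructor
        · rintro ⟨⟨hd0, hdQ⟩, ⟨hn0, hnQ⟩, hdn⟩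
          exact ⟨⟨hdn, by omega⟩, hn0, hnQ⟩
        · rintro ⟨⟨hdn, hn⟩, hn0, hnQ⟩
          have h1 := Nat.le_of_dvd hn0 hdn
          have h2 := Nat.pos_of_dvd_of_pos hdn hn0
          exact ⟨⟨h2, by omega⟩, ⟨hn0, hnQ⟩, hdn⟩
    _ = ∑ n ∈ Ioc 0 Q, n := sum_congr rfl fun n _ => Nat.sum_totient n

/-- `2 ∑_{n ≤ Q} n = Q(Q + 1)`. [folklore] -/
theorem two_mul_sum_Ioc_id (Q : ℕ) : 2 * ∑ n ∈ Ioc 0 Q, n = Q * (Q + 1) := by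
  induction Q with
  | zero => simp
  | succ Q ih => rw [sum_Ioc_succ_top (Nat.zero_le Q), mul_add, ih]; ring

/-- `⌊Q/d⌋ ≤ 2⌊⌊Q/2⌋/d⌋ + 1` for `d ≥ 1`. [folklore] -/
theorem div_le_two_mul_half_div (Q d : ℕ) (hd : 0 < d) : Q / d ≤ 2 * (Q / 2 / d) + 1 := by
  rw [Nat.div_div_eq_div_mul]
  have h2d : 0 < 2 * d := by omega
  set k := Q / (2 * d) with hk
  set r := Q % (2 * d) with hr
  have hQ : Q = r + d * (2 * k) := by
    have := Nat.mod_add_div Q (2 * d); rw [← hr, ← hk] at this; linarith [this]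
  have hrlt : r < 2 * d := Nat.mod_lt _ h2d
  have h1 : Q / d = r / d + 2 * k := by
    rw [hQ, Nat.add_mul_div_left _ _ hd]
  have h2 : r / d ≤ 1 := by
    have : r / d < 2 := (Nat.div_lt_iff_lt_mul hd).mpr (by omega)
    omega
  omega

/-- **`Q² ≤ 4 ∑_{q ≤ Q} φ(q)`** (elementary; the truth is `∑_{q ≤ Q} φ(q) = (3/π²)Q² + O(Q log Q)`
[cite: Apostol1976, Thm 3.7]). Proof: with `T(Q) = ∑_{n ≤ Q} n = ∑_{d ≤ Q} φ(d)⌊Q/d⌋` and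
`H = ⌊Q/2⌋`, `⌊Q/d⌋ ≤ 2⌊H/d⌋ + 1` for `d ≤ H` and `⌊Q/d⌋ ≤ 1` for `d > H` give
`T(Q) ≤ 2T(H) + Φ(Q)`, i.e. `Q(Q+1) ≤ 2H(H+1) + 2Φ(Q) ≤ Q(Q+2)/2 + 2Φ(Q)`. [folklore] -/
theorem sq_le_four_mul_totientSum (Q : ℕ) : Q ^ 2 ≤ 4 * ∑ q ∈ Ioc 0 Q, φ q := by
  set H := Q / 2 with hH
  have hHQ : H ≤ Q := Nat.div_le_self _ _
  have h2H : 2 * H ≤ Q := Nat.mul_div_le Q 2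
  have hQ2H : Q ≤ 2 * H + 1 := by omega
  have hsplit := (sum_Ioc_consecutive (fun d => φ d * (Q / d)) (Nat.zero_le H) hHQ).symm
  have hA : ∑ d ∈ Ioc 0 H, φ d * (Q / d) ≤ 2 * ∑ d ∈ Ioc 0 H, φ d * (H / d) + ∑ d ∈ Ioc 0 H, φ d := by
    rw [mul_sum, ← sum_add_distrib]
    refine sum_le_sum fun d hd => ?_
    have hd0 : 0 < d := (mem_Ioc.mp hd).1
    have := div_le_two_mul_half_div Q d hd0
    rw [← hH] at this
    calc φ d * (Q / d) ≤ φ d * (2 * (H / d) + 1) := Nat.mul_le_mul_left _ this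
      _ = 2 * (φ d * (H / d)) + φ d := by ring
  have hB : ∑ d ∈ Ioc H Q, φ d * (Q / d) ≤ ∑ d ∈ Ioc H Q, φ d := by
    refine sum_le_sum fun d hd => ?_
    have hd' : H < d := (mem_Ioc.mp hd).1
    have : Q / d ≤ 1 := by
      have : Q / d < 2 := (Nat.div_lt_iff_lt_mul (by omega)).mpr (by omega)
      omega
    calc φ d * (Q / d) ≤ φ d * 1 := Nat.mul_le_mul_left _ this
      _ = φ d := mul_one _
  have hΦ : ∑ d ∈ Ioc 0 H, φ d + ∑ d ∈ Ioc H Q, φ d = ∑ d ∈ Ioc 0 Q, φ d :=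
    sum_Ioc_consecutive _ (Nat.zero_le H) hHQ
  have hT : ∑ d ∈ Ioc 0 Q, φ d * (Q / d) ≤ 2 * ∑ d ∈ Ioc 0 H, φ d * (H / d) + ∑ d ∈ Ioc 0 Q, φ d := by
    rw [hsplit, ← hΦ]; omega
  rw [sum_totient_mul_div Q, sum_totient_mul_div H] at hT
  have hTQ := two_mul_sum_Ioc_id Q
  have hTH := two_mul_sum_Ioc_id H
  nlinarith

/-- Hence an admissible constant is `≥ Q²/4`: the `Q²` of `Q² + N − 1` cannot be replaced by
`cQ²` with `c < 1/4` (asymptotically not below `3/π²`). [cite: Montgomery1978, p. 548]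
[cite: Apostol1976, Thm 3.7] -/
theorem sq_div_four_le_of_isLargeSieveConstant {N Q : ℕ} (hN : 1 ≤ N) {Δ : ℝ}
    (h : IsLargeSieveConstant N Q Δ) : (Q : ℝ) ^ 2 / 4 ≤ Δ := by
  have h1 := totientSum_le_of_isLargeSieveConstant hN h
  have h2 : ((Q ^ 2 : ℕ) : ℝ) ≤ ((4 * ∑ q ∈ Ioc 0 Q, φ q : ℕ) : ℝ) := by
    exact_mod_cast sq_le_four_mul_totientSum Q
  have hI : Icc 1 Q = Ioc 0 Q := by ext q; simp only [mem_Icc, mem_Ioc]; omega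
  rw [hI] at h1
  push_cast at h2
  linarith

/-! ### The barrier record -/

/-- **Barrier: the large sieve sets the limit `Q = x^{1/2}` — both terms of the large-sieve
constant `Q² + N − 1` are necessary (Montgomery 1978), so mean-value theorems for progressions
proved through (1.6) stop at moduli `x^{1/2}(log x)^{-B}` (Bombieri–Friedlander–Iwaniec 1986).**
PROVED below (`LargeSieveLevelHalf_holds`): for `N, Q ≥ 1`, `Q² + N − 1` is admissible and every
admissible `Δ` satisfies `N ≤ Δ` and `Q²/4 ≤ Δ`.

BARRIER
technique_class: large-sieve mean-value bombieri-vinogradov level-of-distribution — proofs of mean-value theorems `∑_{q ≤ Q} max_{(a,q)=1} |Δ_f(x;q,a)|` for `f = Λ` or for convolutions `α ⋆ β` subject only to (A₁) (`M = x^{1−ϑ}`, `N = x^ϑ`, `ε ≤ ϑ ≤ 1−ε`) and (A₂) (Siegel–Walfisz for `β`), whose input on the moduli is the large sieve inequality (1.6) = parity.S33 `Literature.NumberTheory.Sieve.large_sieve_inequality` with some admissible constant (`IsLargeSieveConstant N Q Δ`; Vaughan's bilinear form of it in the tree: `Literature.NumberTheory.Sieve.LargeSieve.largeSieve_bilinear`,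 bound `((M+1+2Q²)∑|a|²)^{1/2}((N+1+2Q²)∑|b|²)^{1/2}`) [cite: BombieriFriedlanderIwaniecActa1986, §1 ((A₁), (A₂), (1.5), (1.6))].
blocks: by this route, any level of distribution `x^θ` with `θ > 1/2` for the primes — the range of the Elliott–Halberstam conjecture ((1.4) "may hold with `Q = x^{1−ε}` but even the result with `Q = x^{1/2}` has not yet been achieved") [cite: BombieriFriedlanderIwaniecActa1986, §1 (after (1.4))], in the tree `Literature.NumberTheory.Sieve.LevelOfDistribution.ElliottHalberstam` / `Literature.PrimesHaveLevel θ`, `θ > 1/2` (conjunct of route `MobiusShiftedPrimes` of `GeneralizedHardyLittlewood`; the known range `θ < 1/2` is `Literature.NumberTheory.Sieve.bombieri_vinogradov`, `Literature.NumberTheory.Sieve.BombieriVinogradovStatement`): "It is the application of the large sieve inequality (1.6) that sets the limit `Q = x^{1/2}𝓛^{-B}` and not the shape of the bilinear form `α ⋆ β`. By this we mean that the location of `ϑ` in `[ε, 1 − ε]` in (A₁) is irrelevant to the proof" [cite: BombieriFriedlanderIwaniecActa1986, §1 (paragraph after (1.6))]; AUDIT (2026-08-16, file `LargeSieveLevelHalfNarrow.lean`):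 what the kernel obstructs is the ARCHITECTURE "expand the class in characters over ALL `q ≤ Q`, take absolute values `φ(q)⁻¹∑_χ|A(χ)B(χ)|`, Cauchy–Schwarz, large sieve" — once the moduli exceed the length of a factor, its large-sieve sum is `≥ (∑_{N ≤ p ≤ Q}(p − N))∑|a_n|² ≍ Q²∑|a_n|²/log Q` for EVERY coefficient sequence (`primeSum_mul_le_largeSieveSum`, `primeSum_le_of_bound` there), so the `Q²` is incurred by the actual coefficients and the loss beyond `x^{1/2}` is the cancellation between characters discarded by the absolute values ("would imply some cancellation for sums over zeroes of different `L`-functions") [cite: Maynard2020LargeModuliI, §1 (paragraph after (1.2))]; it does NOT obstruct `max_{(a,q)=1}`-uniform statements beyond `x^{1/2}` as such — see the AUDIT clause of `evasions_known:` [cite: Maynard2020LargeModuliIII, Theorems 1.1–1.3].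
because: an admissible constant must dominate BOTH `N` and `∑_{q ≤ Q} φ(q) ≥ Q²/4` — PROVED (`le_of_isLargeSieveConstant`: constant sequence, the single term `q = 1`; `totientSum_le_of_isLargeSieveConstant`: one-term sequence, every Farey fraction contributes `1`; `sq_le_four_mul_totientSum`), Montgomery's examples "`a_n = e(−nα₁)` … thus `Δ ≥ N`" and, for `[δ⁻¹]` equally spaced points, "`Δ ≥ [δ⁻¹] ≥ δ⁻¹ − 1`", with "The power of the large sieve may be attributed to the fact that we need not take `Δ` to be much larger than is necessitated by the elementary considerations above" [cite: Montgomery1978, p. 548] (Farey fractions of order `Q` are `Q⁻²`-spaced: `δ⁻¹ = Q²`; admissibility of `Q² + N − 1`: `isLargeSieveConstant_sq_add`, [cite: Montgomery1978, Thm 3]); consequently the bilinear large-sieve bound for `∑_{q ≤ Q}` of forms of lengths `M, N` with `MN = x` always contains the term `Q²‖α‖‖β‖`-type contribution of the necessary `Q²`, which exceeds the target `‖α‖‖β‖x^{1/2}𝓛^{-A}` of (1.5) once `Q > x^{1/2}` — the printed diagnosis [cite: BombieriFriedlanderIwaniecActa1986, §1 (paragraph after (1.6))].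
evasions_known: replace (1.6) by "the dispersion method, Fourier analysis and Kloosterman sums, the last appealing to results from the spectral theory of automorphic functions", at the price of a fixed residue `a` (no `max_a`) and of weights: bilinear ranges `θ₁ < 1/3, θ₂ < 1/5, …` (Theorem 8), `∑_{r ≤ R} |∑_{q ≤ Q}(ψ(x;qr,a) − x/φ(qr))|` with `QR < x𝓛^{-B}`, `R < x^{1/10−ε}` (Theorem 9), well-factorable `λ` of level `x^{4/7−ε}` (Theorem 10, whence `π₂(x) ≤ (7/2+ε)B x(log x)^{-2}`, Corollary 2) [cite: BombieriFriedlanderIwaniecActa1986, §1 (Theorems 8–10, Corollary 2)]; level `x^{3/5−ε}` for triply well factorable weights and `x^{7/12−ε}` for the well-factorable linear-sieve weights [cite: Maynard2020LargeModuliII, Theorems 1.1–1.2]; a fixed system of residues `a_q` and smooth (densely divisible) moduli: `θ = 1/2 + 1/584` (Zhang), `θ = 1/2 + 7/300` [cite: Polymath8a2014, Theorem 1.1 and the following paragraph]; with `max_{(a,q)=1}` retained, nothing beyond `Q = x^{1/2}𝓛^{-B}` is published ("even the result with `Q = x^{1/2}` has not yet been achieved") [cite: BombieriFriedlanderIwaniecActa1986,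 §1 (after (1.4))]; AUDIT (2026-08-16): the last clause is SUPERSEDED for structured moduli — with `sup_{(a,q)=1}` INSIDE the sum over moduli, level `x^{1/2+δ}` is published for `q = q₁q₂`, `q₁ ∼ Q₁ ≤ x^{1/10−3δ}(log x)^{-C}`, `q₂ ∼ Q₂ ≤ x^{4/10+4δ}(log x)^C` ("`≪_C δπ(x) + x(log log x)²/(log x)²`", Theorem 1.1), for triply factorable `q₁q₂q₃ = x^{1/2+δ}` with `a mod q₁q₂` fixed uniformly in `q₃` (saving `(log x)^{-A}`, Theorem 1.2), and with full uniformity for a prime minorant `ρ ≤ 1_ℙ`, `∑ρ ≥ π(x)/8` (Theorem 1.3; primes in every primitive class for almost all such moduli, Corollary 1.4) [cite: Maynard2020LargeModuliIII, Theorems 1.1–1.3 and Corollary 1.4]; the `a`-dependence belongs to the spectral Kloosterman-sum input alone ("Any method exploiting bounds for sums of Kloosterman sums via the spectral theory of automorphic forms necessarily introduces a dependence on the residue class"), the algebraic-geometry exponential sums of Zhang and Polymath being `a`-uniform (Polymath: `sup_{a ∈ ℤ}` outside the sum over `x^δ`-smooth `q ≤ x^{1/2+δ}`) [cite: Maynard2020LargeModuliIII,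 §1]; further fixed-`a` evasions: absolute values over moduli `q ≤ x^{1/2+δ}` with a conveniently sized factor, up to `x^{11/21−ε}` [cite: Maynard2020LargeModuliI, Theorem 1.1 and Corollaries 1.2–1.4], level `x^{20/39−δ}` for bounded multiplicative functions (Green for prime moduli; Bettin–Chandee) [cite: GranvilleShao2019BeyondHalf, Abstract and §1.4 (Theorems 1.8–1.9)]; what has no published improvement is the COMPLETE family `q ≤ x^{1/2+ε}` — with or without `sup_a` — at log-power saving: over all `q ∼ x^{1/2+δ}` only `δ²x/log x + x(log log x)^{O(1)}/(log x)³` for fixed `a` (Bombieri–Friedlander–Iwaniec II/III) is known [cite: Maynard2020LargeModuliI, §1.1 (Theorem 1 and the comparison)].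
scope_caveats: (a) "sets the limit" is the authors' diagnosis of the METHOD; no theorem says that (1.4) is false or unprovable for `x^{1/2} < Q ≤ x^{1−ε}` — it is conjectured there (Elliott–Halberstam) [cite: BombieriFriedlanderIwaniecActa1986, §1 (after (1.4))] and refuted only at `Q = x(log x)^{-B}` (tree entries `Literature/Barriers/Parity/FriedlanderGranvilleUniformity.lean`, `EquidistributionLimits.lean`); (b) the proved necessity is worst-case over ALL sequences `a_n` (Montgomery's examples are the constant and the one-term sequence), and says nothing about the special bilinear forms built from `Λ`, nor about arguments that exploit their structure — exactly what the evasions do [cite: BombieriFriedlanderIwaniecActa1986, §1 (paragraph after (1.6))]; AUDIT (2026-08-16): sharper — the necessity is NOT only worst-case: at a prime modulus `p ≥ N` every sequence has `∑_{0<b<p}|S(b/p)|² ≥ (p − N)∑|a_n|²` (Parseval modulo `p`; `sub_mul_le_sum_coprime_prime`, `primeSum_mul_le_largeSieveSum` in `LargeSieveLevelHalfNarrow.lean`), so for `Q` beyond the length of the shorter factor (`≤ x^{1/2}`) the bound of (1.6) is attained up to `O(log Q)` by the special bilinear forms too; the evasions win cancellation between harmonics for a fixed class / structured moduli, i.e.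 they leave the architecture BEFORE the absolute values, they do not exploit a slack in (1.6) ("To break the `x^{1/2}`-barrier, we need to reduce the `Q²` … by using Fourier analysis to obtain some cancellation. We will be able to do this when the residue classes `a_q` do not vary with `q`") [cite: GranvilleShao2019BeyondHalf, §7 (first paragraph)]; (c) Montgomery's examples are printed for the trigonometric form `∑_r |S(α_r)|²` with `δ`-spaced points [cite: Montgomery1978, p. 548]; the Farey form proved here has second example `∑_{q ≤ Q} φ(q) = (3/π²)Q² + O(Q log Q)` [cite: Apostol1976, Thm 3.7], of which only the elementary `≥ Q²/4` is proved; (d) the dispersion route has its own printed ceiling — "It appears that handling moduli of size `x^{3/5−ε}` is the limit of the current method" [cite: Maynard2020LargeModuliII, §1] — not formalised here; (e) the entry concerns the distribution INPUT only: even level `θ = 1` does not by itself yield the binary Hardy–Littlewood asymptotics (parity; tree entries `PrimePairParity.lean`, `FordMaynardPrimeSieves.lean`, `SelbergParity.lean`).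
status: established — the optimality is a theorem (`LargeSieveLevelHalf_holds`; [cite: Montgomery1978, p. 548]); the barrier reading is the statement printed in [cite: BombieriFriedlanderIwaniecActa1986, §1 (paragraph after (1.6))]; NARROWED by the 2026-08-16 audit (record `LargeSieveLevelHalfNarrow`, PROVED as `LargeSieveLevelHalfNarrow_holds` and implying this one via `LargeSieveLevelHalf_of_narrow`, file `LargeSieveLevelHalfNarrow.lean`: every-sequence sharpness of (1.6) at prime moduli; `sup_a` retained beyond `x^{1/2}` for factorable moduli) [cite: Maynard2020LargeModuliIII, Theorems 1.1–1.3]. -/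
def LargeSieveLevelHalf : Prop :=
  ∀ N Q : ℕ, 1 ≤ N → 1 ≤ Q →
    IsLargeSieveConstant N Q ((Q : ℝ) ^ 2 + N - 1) ∧
      ∀ Δ : ℝ, IsLargeSieveConstant N Q Δ → (N : ℝ) ≤ Δ ∧ (Q : ℝ) ^ 2 / 4 ≤ Δ

/-- **Proof of the barrier record `LargeSieveLevelHalf`.** [cite: Montgomery1978, p. 548 and Thm 3] -/
theorem LargeSieveLevelHalf_holds : LargeSieveLevelHalf := fun N Q hN hQ =>
  ⟨isLargeSieveConstant_sq_add N Q, fun _ h =>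
    ⟨le_of_isLargeSieveConstant hN hQ h, sq_div_four_le_of_isLargeSieveConstant hN h⟩⟩

/-- The two necessary terms together: `max(N, Q²/4) ≤ Δ ≤ Q² + N − 1` brackets the optimal
constant within a factor `< 5`. [cite: Montgomery1978, p. 548] -/
theorem max_le_of_isLargeSieveConstant {N Q : ℕ} (hN : 1 ≤ N) (hQ : 1 ≤ Q) {Δ : ℝ}
    (h : IsLargeSieveConstant N Q Δ) : max (N : ℝ) ((Q : ℝ) ^ 2 / 4) ≤ Δ :=
  max_le (le_of_isLargeSieveConstant hN hQ h) (sq_div_four_le_of_isLargeSieveConstant hN h)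

end Literature.Barriers.Parity
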